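/-
Copyright: cell pub-balaban-gaps (YM BLITZ Y1, track G1), seat g1-p2 GEN 4 (unit `pub-balaban-gaps-g1-p2`).  Row (D4) NODE O,
OBJECT ∕ MECHANISM level: the SUM step of the walk-expansion calculus at the FULL `JointWalkExpansion` shape — two walk-expanded
kernel families on the same rows ∕ columns ∕ σ-region add to a walk-expanded family on the disjoint union of the term indices
(plan-1 L-5 «foreseen S-piece `jointWalkExpansion_add`», for the precision slot `1 + H` of the model term).  HONEST FRAMING:
bookkeeping over a landed hypothesis SHAPE; nothing of Bałaban's constructed or asserted; (D4) NOT discharged (instance 0∕1);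
NOT BetaPertH, NOT continuum, NOT Clay.
-/
import Literature.MathematicalPhysics.QuantumFieldTheory.Balaban1983to89.B13JointWalkExpansion

/-!
# `Gaps.D4WalkSum` — the sum of two joint walk expansions is a joint walk expansion (cell pub-balaban-gaps, seat g1-p2 gen 4)

HONEST DEPENDENCY (cell pub-balaban, verbatim): continuum YM on T⁴ ⇐ BetaPertH ∧ nine spine estimates (0/9 proved);
BetaPertH ⇐ (D1) ∧ (D4) ∧ CAP+tail.

`jointWalkExpansion_add`: joint walk expansions of `K₁` (terms `T₁` on `W₁`, per-term rate `ρ₁`, window `ε₁`, torus rate `κ₁`,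
constant `K̄₁`) and of `K₂` (on `W₂`, `ρ₂, ε₂, κ₂, K̄₂`) with the same locators, σ-region `X` and ball give a joint walk expansion
of `K₁ + K₂` on `W₁ ⊕ W₂` (terms, σ-carrying sub-families, amplitudes and walk distances by `Sum.elim`) at any common rate `ρ ≤ ρᵢ`
whose window `ε ≥ 0` fits inside both windows (`ρᵢ − εᵢ ≤ ρ − ε`), torus rate `κ ≤ κᵢ`, constant `K̄₁ + K̄₂`: `hasSum` by
Mathlib's `HasSum.sum` over the sum type, `majSum` by splitting a finite set of `W₁ ⊕ W₂` into its left and right parts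
(`Finset.toLeft_disjSum_toRight`, `Finset.sum_disjSum`), the other fields componentwise; `domBy_add`;
`jointWalkExpansion_add_same` (both summands at one `(ρ₀, ε₀, κ₀)`).  [B9] Thm 3.10 p. 416: the constants of (3.108) *"may be weakened freely"* — the envelope.
Value: kernel-checked bookkeeping, NOT summit progress; nothing of Bałaban's asserted; words of row (D4) UNCHANGED.
-/

noncomputable section

namespace Summit.QuantumFields.BalabanUV.Gaps.D4WalkSum

open Metric Set Finset
open Literature.MathematicalPhysics.QuantumFieldTheory.Balaban1983to89
open Literature.MathematicalPhysics.QuantumFieldTheory.Balaban1983to89.B9SectDWalk (Through MajSumLe DomBy)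
open Literature.MathematicalPhysics.QuantumFieldTheory.Balaban1983to89.B9Thm34Ext (toB6)
open Literature.MathematicalPhysics.QuantumFieldTheory.Balaban1983to89.B9Thm37GlueTorus (torusGeom tdist1 tdist1_nonneg)
open Literature.MathematicalPhysics.QuantumFieldTheory.Balaban1983to89.TreeLengthTorus (TPt)
open Literature.MathematicalPhysics.QuantumFieldTheory.Balaban1983to89.B5TorusCover (UT)
open Literature.MathematicalPhysics.QuantumFieldTheory.Balaban1983to89.B13JointWalkExpansion (JointWalkExpansion WalkMajorants)

variable {ν : ℕ} {Nf : Fin ν → ℕ} [∀ i, NeZero (Nf i)]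
variable {d N' : ℕ} {p n : Type}
variable {E : Type*} [NormedAddCommGroup E] [NormedSpace ℂ E]
variable {c₀ : B13.Consts} {locp : p → UT Nf} {locn : n → UT Nf} {X : Finset (UT Nf)} {R : ℝ}
variable {K₁ K₂ : (TPt d N' → ℂ) → E → Matrix p n ℂ}
variable {W₁ W₂ : Type} {T₁ : W₁ → (TPt d N' → ℂ) → E → Matrix p n ℂ} {T₂ : W₂ → (TPt d N' → ℂ) → E → Matrix p n ℂ}
variable {SX₁ : Set W₁} {SX₂ : Set W₂}
variable {A₁ : W₁ → ℝ} {A₂ : W₂ → ℝ} {D₁ : W₁ → UT Nf → UT Nf → ℝ} {D₂ : W₂ → UT Nf → UT Nf → ℝ}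
variable {ρ₁ ρ₂ ε₁ ε₂ κ₁ κ₂ Kbar₁ Kbar₂ ρ ε κ : ℝ}

/-- **Splitting a partial sum over `W₁ ⊕ W₂`**: a majorant family on the sum type whose left and right parts have partial sums
bounded by `B₁`, `B₂` has partial sums bounded by `B₁ + B₂`. [cite: Balaban1985BackgroundPropagators, (3.108) p.416] -/
theorem majSumLe_sum {g : B6.Geometry} {M₁ : W₁ → g.Site → g.Site → ℝ} {M₂ : W₂ → g.Site → g.Site → ℝ}
    {B₁ B₂ : g.Site → g.Site → ℝ} (h₁ : MajSumLe M₁ B₁) (h₂ : MajSumLe M₂ B₂) :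
    MajSumLe (fun ω : W₁ ⊕ W₂ => Sum.elim M₁ M₂ ω) (fun a b => B₁ a b + B₂ a b) := by
  intro S a b
  rw [← Finset.toLeft_disjSum_toRight (u := S), Finset.sum_disjSum]
  exact add_le_add (h₁ S.toLeft a b) (h₂ S.toRight a b)

/-- Weakening a per-term bound to a smaller rate (`D ≥ 0`, `A ≥ 0`). [cite: Balaban1985BackgroundPropagators, (3.108) p.416] -/
theorem maj_mono_rate {A D r r' : ℝ} (hA : 0 ≤ A) (hD : 0 ≤ D) (h : r' ≤ r) :
    A * Real.exp (-(r * D)) ≤ A * Real.exp (-(r' * D)) :=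
  mul_le_mul_of_nonneg_left (Real.exp_le_exp.2 (by nlinarith)) hA

/-- **THE SUM OF TWO JOINT WALK EXPANSIONS IS A JOINT WALK EXPANSION** (same locators, σ-region and ball; rates: `ρ ≤ ρ₁, ρ₂`,
`ρᵢ − εᵢ ≤ ρ − ε`, `κ ≤ κ₁, κ₂`, `0 ≤ K̄ᵢ`): terms on `W₁ ⊕ W₂`, σ-carrying sub-family ∕ amplitudes ∕ distances by
`Sum.elim`, rate `ρ`, window `ε`, torus rate `κ`, constant `K̄₁ + K̄₂`. [cite: Balaban1985BackgroundPropagators, (3.107)–(3.108) p.416; Balaban1988RG2Cluster, (1.11) p.5, p.13, p.15] -/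
theorem jointWalkExpansion_add
    (h₁ : JointWalkExpansion c₀ locp locn K₁ X R ε₁ κ₁ Kbar₁ T₁ SX₁ A₁ D₁ ρ₁)
    (h₂ : JointWalkExpansion c₀ locp locn K₂ X R ε₂ κ₂ Kbar₂ T₂ SX₂ A₂ D₂ ρ₂)
    (hρ₁ : ρ ≤ ρ₁) (hρ₂ : ρ ≤ ρ₂) (hw₁ : ρ₁ - ε₁ ≤ ρ - ε) (hw₂ : ρ₂ - ε₂ ≤ ρ - ε)
    (hκ₁ : κ ≤ κ₁) (hκ₂ : κ ≤ κ₂) (hK₁ : 0 ≤ Kbar₁) (hK₂ : 0 ≤ Kbar₂) :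
    JointWalkExpansion c₀ locp locn (fun σ₀ u => K₁ σ₀ u + K₂ σ₀ u) X R ε κ (Kbar₁ + Kbar₂)
      (fun (ω : W₁ ⊕ W₂) => Sum.elim T₁ T₂ ω) {ω | Sum.elim (· ∈ SX₁) (· ∈ SX₂) ω}
      (fun ω => Sum.elim A₁ A₂ ω) (fun ω => Sum.elim D₁ D₂ ω) ρ where
  hasSum σ₀ hσ₀ u hu i j := by
    rw [Matrix.add_apply]
    exact HasSum.sum (f := fun ω : W₁ ⊕ W₂ => Sum.elim T₁ T₂ ω σ₀ u i j) (h₁.hasSum σ₀ hσ₀ u hu i j)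
      (h₂.hasSum σ₀ hσ₀ u hu i j)
  termAnalytic ω σ₀ hσ₀ i j := by
    rcases ω with ω | ω
    · exact h₁.termAnalytic ω σ₀ hσ₀ i j
    · exact h₂.termAnalytic ω σ₀ hσ₀ i j
  maj ω σ₀ hσ₀ u hu i j := by
    rcases ω with ω | ω
    · exact (h₁.maj ω σ₀ hσ₀ u hu i j).trans (maj_mono_rate (h₁.A_nonneg ω) (h₁.D_nonneg ω _ _) hρ₁)
    · exact (h₂.maj ω σ₀ hσ₀ u hu i j).trans (maj_mono_rate (h₂.A_nonneg ω) (h₂.D_nonneg ω _ _) hρ₂)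
  majSum := by
    -- each part: weaken the reduced rate to the factor's, then the torus rate to κ
    have g₁ : MajSumLe (g := toB6 (torusGeom Nf 0 0 0) 0 True) (fun ω a b => A₁ ω * Real.exp (-((ρ - ε) * D₁ ω a b)))
        (fun a b => Kbar₁ * Real.exp (-(κ * tdist1 Nf a b))) := by
      intro S a b
      refine (Finset.sum_le_sum fun ω _ => maj_mono_rate (h₁.A_nonneg ω) (h₁.D_nonneg ω a b) hw₁).trans
        ((h₁.majSum S a b).trans (maj_mono_rate hK₁ (tdist1_nonneg a b) hκ₁))
    have g₂ : MajSumLe (g := toB6 (torusGeom Nf 0 0 0) 0 True) (fun ω a b => A₂ ω * Real.exp (-((ρ - ε) * D₂ ω a b)))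
        (fun a b => Kbar₂ * Real.exp (-(κ * tdist1 Nf a b))) := by
      intro S a b
      refine (Finset.sum_le_sum fun ω _ => maj_mono_rate (h₂.A_nonneg ω) (h₂.D_nonneg ω a b) hw₂).trans
        ((h₂.majSum S a b).trans (maj_mono_rate hK₂ (tdist1_nonneg a b) hκ₂))
    have g := majSumLe_sum g₁ g₂
    intro S a b
    have e : ∀ ω : W₁ ⊕ W₂, Sum.elim A₁ A₂ ω * Real.exp (-((ρ - ε) * Sum.elim D₁ D₂ ω a b)) =
        Sum.elim (fun ω a b => A₁ ω * Real.exp (-((ρ - ε) * D₁ ω a b)))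
          (fun ω a b => A₂ ω * Real.exp (-((ρ - ε) * D₂ ω a b))) ω a b := by
      rintro (ω | ω) <;> rfl
    calc ∑ ω ∈ S, Sum.elim A₁ A₂ ω * Real.exp (-((ρ - ε) * Sum.elim D₁ D₂ ω a b))
        = ∑ ω ∈ S, Sum.elim (fun ω a b => A₁ ω * Real.exp (-((ρ - ε) * D₁ ω a b)))
            (fun ω a b => A₂ ω * Real.exp (-((ρ - ε) * D₂ ω a b))) ω a b := Finset.sum_congr rfl fun ω _ => e ω
      _ ≤ Kbar₁ * Real.exp (-(κ * tdist1 Nf a b)) + Kbar₂ * Real.exp (-(κ * tdist1 Nf a b)) := g S a b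
      _ = (Kbar₁ + Kbar₂) * Real.exp (-(κ * tdist1 Nf a b)) := by ring
  indep ω hω σ₀ hσ₀ := by
    rcases ω with ω | ω
    · exact h₁.indep ω hω σ₀ hσ₀
    · exact h₂.indep ω hω σ₀ hσ₀
  through ω hω := by
    rcases ω with ω | ω
    · exact h₁.through ω hω
    · exact h₂.through ω hω
  A_nonneg ω := by
    rcases ω with ω | ω
    · exact h₁.A_nonneg ω
    · exact h₂.A_nonneg ω
  D_nonneg ω a b := by
    rcases ω with ω | ω
    · exact h₁.D_nonneg ω a b
    · exact h₂.D_nonneg ω a b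

/-- **Domination for the sum family** (`Sum.elim` of dominating distances dominates). [cite: Balaban1984PropagatorsII, (2.54) p.233] -/
theorem domBy_add (hd₁ : ∀ ω, DomBy (toB6 (torusGeom Nf 0 0 0) 0 True) (D₁ ω))
    (hd₂ : ∀ ω, DomBy (toB6 (torusGeom Nf 0 0 0) 0 True) (D₂ ω)) (ω : W₁ ⊕ W₂) :
    DomBy (toB6 (torusGeom Nf 0 0 0) 0 True) (Sum.elim D₁ D₂ ω) := by
  rcases ω with ω | ω
  · exact hd₁ ω
  · exact hd₂ ω

/-- **The same window, both summands** (the form a uniform package uses): both expansions at `(ρ₀, ε₀, κ₀)` ⟹ the sum at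
`(ρ₀, ε₀, κ₀)` with constant `K̄₁ + K̄₂`. [cite: Balaban1985BackgroundPropagators, (3.108) p.416] -/
theorem jointWalkExpansion_add_same {ρ₀ ε₀ κ₀ : ℝ}
    (h₁ : JointWalkExpansion c₀ locp locn K₁ X R ε₀ κ₀ Kbar₁ T₁ SX₁ A₁ D₁ ρ₀)
    (h₂ : JointWalkExpansion c₀ locp locn K₂ X R ε₀ κ₀ Kbar₂ T₂ SX₂ A₂ D₂ ρ₀)
    (hK₁ : 0 ≤ Kbar₁) (hK₂ : 0 ≤ Kbar₂) :
    JointWalkExpansion c₀ locp locn (fun σ₀ u => K₁ σ₀ u + K₂ σ₀ u) X R ε₀ κ₀ (Kbar₁ + Kbar₂)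
      (fun (ω : W₁ ⊕ W₂) => Sum.elim T₁ T₂ ω) {ω | Sum.elim (· ∈ SX₁) (· ∈ SX₂) ω}
      (fun ω => Sum.elim A₁ A₂ ω) (fun ω => Sum.elim D₁ D₂ ω) ρ₀ :=
  jointWalkExpansion_add h₁ h₂ le_rfl le_rfl le_rfl le_rfl le_rfl le_rfl hK₁ hK₂

end Summit.QuantumFields.BalabanUV.Gaps.D4WalkSum

end
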